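import Mathlib
import Summits.NavierStokesRegularity.NavierStokesRegularity.Theses.TypeIQuarterGate
import Literature.Analysis.FluidPDE.ClassicalSolution
import Literature.Analysis.FluidPDE.LerayHopf
import Literature.Analysis.FluidPDE.SuitableWeak
import Literature.Analysis.FluidPDE.SelfSimilar
import Literature.Analysis.FluidPDE.TypeIAncientMild
import Literature.Analysis.FluidPDE.NSLerayHopfProofs
import Literature.Analysis.FluidPDE.ESSLocalHolderHolds
-- LANDED on line `scar_zoom` (ns-sz-p1 g2): the five shared definitions (p606736) and STUB A (p607379)
import Summits.NavierStokesRegularity.NavierStokesRegularity.Theorems.TypeIQuarterGateScarZoomDefs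
import Summits.NavierStokesRegularity.NavierStokesRegularity.Theorems.TypeIQuarterGateScarEnvelopeTypeIViolatorsApproachScar
-- LANDED on line `scar_zoom` (ns-sz-p1 g2, 07:13Z): STUB 0 (p611204) and scar_zoom's S_B twin zoom (p610713)
import Summits.NavierStokesRegularity.NavierStokesRegularity.Theorems.TypeIQuarterGateScarEnvelopeTypeIBlowupIsCompact
import Summits.NavierStokesRegularity.NavierStokesRegularity.Theorems.TypeIQuarterGateScarEnvelopeTypeIScarZoom
-- LANDED for line `slice_budget` (ns-sz-p1 g3, LEAD, 07:32Z): the five SliceBudget definitions (p612755)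
import Summits.NavierStokesRegularity.NavierStokesRegularity.Theorems.TypeIQuarterGateSliceBudgetDefs
-- LANDED for line `slice_budget` (ns-sz-p1 g3, LEAD, 08:20Z): STUB B `stub_tameScarZoom` (p615740; helpers
-- p613362 …BudgetCompactness, p613696/p614211 …BudgetTools, p614802 …BudgetZoomLimit)
import Summits.NavierStokesRegularity.NavierStokesRegularity.Theorems.TypeIQuarterGateScarEnvelopeTypeITameScarZoom
-- v7 (ns-idea-7 g3, KEY-NS #108 (3)): the Albritton–Barker class of the tree's zoom limits and its
-- final-time singular set (`typeIBound`, `IsSuitableWeakSolutionInBall`, `IsBackwardSingularPoint`)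
import Literature.Analysis.FluidPDE.LocalTypeI
import Summits.NavierStokesRegularity.NavierStokesRegularity.Theorems.TypeIQuarterGateScarEnvelopeTypeIBudgetZoomLimit

/-!
# Line `slice-budget` — crux `TypeIQuarterGate.ScarEnvelopeTypeI` (stmt-NavierStokesRegularity-23843)

D-0145 ideator seat ns-idea-7, generation g2 (lens «nearmiss», target «DSS wall»).  NO SUMMIT IS
PROVED BY THIS LINE: it is a crux-level skeleton — registered stubs `stub_*` (the only `sorry`s) and
a kernel-checked composition `ScarEnvelopeTypeI_of` concluding the crux BY NAME.

THE NEAR-MISS OF RECORD (two tree theorems and the measured gap between them and the crux).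
* `Literature.Analysis.FluidPDE.ess_local_holder_holds` — Escauriaza–Seregin–Šverák 2003, Thm 1.4,
  PROVED in the tree: a distributional Navier–Stokes pair on the unit backward cylinder in the local
  energy class with `v ∈ L^∞_t L³_x(Q₁)` is Hölder continuous on the closure of `Q(1/2)` — in
  particular its vertex is NOT a singular point.
* `Literature.Analysis.FluidPDE.scaledEnergies_bounded_of_typeIRate` — Seregin–Šverák 2009 L.3.5 /
  Seregin 2014 Prop 3.11, PROVED: the Type-I time RATE at a vertex bounds every scale-invariant energy
  there, in particular the SLICE-WISE scaled `L²` mass `A(r) = sup_t r⁻¹∫_{B_r}|u(t)|²` and the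
  parabolic-TIME-AVERAGED cube `C(r) = r⁻²∫∫_{Q_r}|u|³`.
* The crux's conclusion (the multi-scar envelope `|u| ≤ C' + Σ_a C'/(|x−a|+√(T−t))`) implies the
  SLICE-WISE annular cube budget `∫_{ℓ<|x−a|<eℓ} |u(t)|³ ≤ q` at every scar `a`, every time near
  `T` and every parabolically admissible radius `√(ν(T−t)) ≤ ℓ ≤ r₀` (elementary: the profile
  `C'/(|y−a|+ℓ)` deposits ≤ 4πC'³ of cube per e-annulus).  MEASURED DEFICIT: the tree bounds the
  annular cube ON PARABOLIC TIME AVERAGE (`C ≤ K`) and the annular `L²` mass SLICE-WISE (`A ≤ K`);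
  the crux needs the annular CUBE slice-wise.  The single input to improve is that exchange
  (average → slice, or `L²` → `L³` on a slice): `stub_sliceOctaveBudget`, the DECIDING stub, which is
  WEAKER than the crux.
* Why the budget is exactly what is missing: zoom at a scar along envelope violators (g0 line
  `scar_zoom`, stubs 0/A kept verbatim) gives a Type-I ancient mild solution singular at the origin
  AND at a point `e` of the unit sphere; the annular budget is scale invariant, passes to the limit,
  and puts `B(e,1/2) ⊂ {1/2 < |y| < 3/2}` inside TWO e-annuli of the origin, so the limit lies in
  `L^∞_s L³(B(e,1/2))` — and then ESS's local theorem says `e` is regular.  Contradiction.  So the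
  open one-point-rigidity Liouville theorem of `scar_zoom` (critic price P1/P4: width 0, stronger than
  the crux) is REPLACED by a 2003 theorem, and what remains open is a statement strictly below the crux.
  (Weak-`L³` control would NOT do: `|y−e|⁻¹` is weak-`L³`; the e-annular summability of the cube is
  precisely ESS's hypothesis.  This is also why Barker–Prange 2021 §4 / Choe–Wolf–Yang 2019, all in
  the weak-`L³` Type-I class, do not reach the rate class of this crux — Albritton–Barker 2019 p. 4:
  the Type-I notions "are not known to imply each other".)

STUBS (sizes are Lean sizes):
* `stub_blowupIsCompact` (S0; v4: the LANDED `ScarZoom` theorem p611204, used by name): tameness outside the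
  blow-up region.
* `stub_violatorsApproachScar` (SA, M; v3: the LANDED `ScarZoom` theorem p607379, used by name): ¬envelope ⇒ violators
  accumulate at a scar, parabolically far from it.
* `stub_sliceOctaveBudget` (SD, DECIDING, open, XL): rate + finitely many scars ⇒ slice-wise annular
  cube budget at every singular point.
* `stub_tameScarZoom` (SB, XL in Lean, compactness infrastructure with every analytic input a tree
  theorem): violators + budget ⇒ a TAME TWIN-SCAR object (second scar in the ESS class).
* PROVED here (no sorry): `noTameTwinScar` — there is no tame twin-scar object (ESS Thm 1.4 via
  `ess_local_holder_holds`, continuity of the KNSS-gauge representative, and the pointwise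
  singularity clause); and the composition `ScarEnvelopeTypeI_of : S0 → SA → SD → SB → crux`.

ON THE DSS WALL: an enveloped backward λ-DSS / self-similar Type-I blow-up satisfies the budget with
`q = sup_R ∫_{R<|y|<eR} |U|³ < ∞` (profile decay `|U(y)| ≲ C'/|y|`), so unlike the Liouville stubs
of the 24077 lines this deciding stub has POSITIVE WIDTH on the wall; its enemies are non-self-similar
(see the stub's docstring).  bears_on: LADDER-NS N0 via TypeIQuarterGate (23843 = split child 2 of
QuarterLawTypeI 23726).  No summit is proved by this line.

VERSION 2 (2026-08-28, after idea-crit-7's VERDICT 06:13:26Z PASS-WITH-PRICE — «the better of the two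
23843 lines»; statements UNCHANGED, docstrings only): P1 the two-sided near-miss datum (Barker–Prange
2021 Result 1: the octave budget from BELOW, so STUB D's `q·log` shape is sharp in order) recorded in
STUB D; P2 the spanning-filament clause of STUB D's enemy census marked heuristic (residual enemy =
swarms OR transient filaments); STUB B's scaled-energy step restated per vertex (one `K` at `(T,a)`);
P3/P4 (registration timing: keep `scar_zoom` registered while its S_B is being landed, then switch the
crux's registration to this line importing the landed S0/SA/S_B theorems delta-equally instead of
re-registering them as stubs) are the director's call and are recorded in the card.
VERSION 3 (same day; statements UNCHANGED as Props): P4 executed ahead of time — the shared definitions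
and STUB A are now the LANDED `ScarZoom` declarations used BY NAME (imports above), so this file's
sorries are exactly S0 / SD / SB (3); the registration switch itself (P3) waits for `scar_zoom`'s S_B and
the director.
VERSION 4 (07:15Z, after ns-sz-p1 g2 landed S0 p611204 and S_B p610713 and re-registered `scar_zoom` v7
ea05561032f9 with only its width-0 S_C left): S0 by name too; imports the twin-zoom theorem for STUB B's
prover; sorries = 2 = SD / SB; all stub statements unchanged as Props (critic: no re-probe).  This is the
switch-ready skeleton of idea-crit-7's P3; registration on the director's word.
VERSION 5 (LEAD ns-sz-p1 g3, after KEY-NS #87 (3) «23843 SWITCH = APPROVED» and the line owner's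
statement freeze 07:27:58Z): the five SliceBudget definitions `SingularPt`, `OctaveBudget`,
`essTranslate`, `ESSClassAt`, `TameTwinScar` are now the LANDED tree declarations of
`Theorems/TypeIQuarterGateSliceBudgetDefs.lean` (p612755, same namespace, copied verbatim from v4) and
are therefore DROPPED from this file (imported above); stub statements SD / SB, `noTameTwinScar` and
`ScarEnvelopeTypeI_of_stubs`' statement are unchanged; the composition is re-cut so that
`ScarEnvelopeTypeI_of_stubs` is the unique crux-concluding theorem (see `## Composition`).  This is
the version registered as 23843's skeleton of record (stubs SD `stub_sliceOctaveBudget`, SB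
`stub_tameScarZoom`); no stub statement changed.
VERSION 6 (LEAD ns-sz-p1 g3, 08:25Z): STUB B `stub_tameScarZoom` is LANDED (p615740, reviewed, unconditional,
stub credit by name) and is now the tree theorem `SliceBudget.stub_tameScarZoom` used BY NAME (import
above; its in-file `sorry` copy dropped).  The ONLY remaining `sorry` is the deciding stub SD
`stub_sliceOctaveBudget` (instrument-first per KEY-NS #87 (3)); with the landed S0 / SA / SB the crux is
EQUIVALENT to SD (`Theorems/…SliceBudgetReduction.lean`: the envelope implies the octave budget).
VERSION 7 (ns-idea-7 g3, 2026-08-28T09:40Z, FILES-ONLY per KEY-NS #108 (3): the LEAD registers; no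
`skeleton check` by this seat).  THE DECIDING STUB SD IS SPLIT ALONG THE `H¹` SEAM OF THE NULL TABLE
(RESULT-28 `Null28.lean` c95cef85bcbfdce0: under Type-I + slice-`L²` the enemy of SD is AT MOST
ONE-DIMENSIONAL; LEAD ns-sz-p1 g4 structural input 08:58:03Z: the provable seam is `H¹`-FAT vs
`H¹`-NULL DUST).  SD's STATEMENT IS UNCHANGED (token-identical Prop, now ALSO named `SD`); it is no
longer a `sorry` but the kernel-checked consequence `SD_of : FatKill → DustKill → SD` of two NEW stubs:
* `stub_fatKill` (SF, size L, PROVABLE NOW, claimed by the LEAD as by-name helper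
  `Theorems/TypeIQuarterGateScarEnvelopeTypeITopTimeCKN.lean`): every object of the Albritton–Barker
  class `ABClass` in which the tree's scar zooms land (`exists_typeIAncientMild_twinZoomLimit_budget`:
  KNSS-gauge Type-I ancient mild, suitable weak in every backward ball at the top vertex, weak gradient
  on the open past, A–B Type-I quantity `𝐈 < ⊤`) has `H¹`-NULL FINAL-TIME SINGULAR SET
  `μH[1] {x | IsBackwardSingularPoint U (0,x)} = 0` — CKN 1982 AT THE TOP TIME under the Morrey bound
  (Seregin L.6.2 `exists_cknC_le_decay` + L.6.4 `pressureEstimateMeanZero_top` ⇒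
  `exists_epsilonRegularity_top`; contrapositive + spatial Vitali on top-vertex backward cylinders with
  `ρ⁻¹∫∫_{Q_ρ(0,x)}|∇U|² ≥ η₀` + absolute continuity of the dissipation on shrinking top slabs ⇒
  `μH[1] = 0`, Mathlib `hausdorffMeasure_le_liminf_sum`).  KILLS, with no Liouville theorem: COHERENT
  FILAMENTS (`N_k → ∞` cells, diameter `≥ c N_k √(T−t_k)`: zoom at their own scale gives a final-time
  singular continuum), SHEETS, FOG, ARC-SWARMS — every scenario one of whose scar zoom limits is
  `H¹`-fat at the final time.
* `stub_dustKill` (SK, DECIDING, open, size XL but STRICTLY BELOW SD): SD for blow-ups ALL OF WHOSE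
  A–B-class ZOOM LIMITS AT EVERY POINT (`IsZoomLimitAt`: centres `x_n → a`, vertex times `t_n ≤ T` with
  `(T − t_n)/λ_n² → 0`, scales `λ_n → 0`, pointwise convergence on the open past — the weakest notion,
  so the hypothesis is the strongest) have `H¹`-null final-time singular sets (`FinalDustOnly`).  WHAT
  SURVIVES ON THIS SIDE = DUST: `N_k → ∞` parabolic grains clustering geometrically onto points (cube
  `≍ C₀³ log(ℓ²/(T−t))` — exactly Barker–Prange 2021's lower-bound shape) or Cantor-like dusts of
  dimension `< 1`, whose zoom limits are twin-, multi- or Cantor-scar Type-I ancient objects with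
  `H¹`-null final singular set (the old S_C′ wall generalised, and `noTameTwinScar`'s ESS leg still
  kills the budgeted ones).  In the null table's words: COHERENT-filament kill ⊂ SF; SWARM kill splits —
  arc-like swarms ∈ SF, geometric grain swarms ∈ SK.  Instrument row for SK: p3's `N_far` / `H` words
  re-read as a box-counting dimension of grain centres per annulus (dimension ≥ 1 persisting to `T` ⇒
  SF's side, fired; dimension < 1 ⇒ SK's residual enemy, census it).
`SD_of` is modus ponens through `FinalDustOnly` (SF supplies SK's hypothesis at every point, zoom limit
or not); the crux-concluding theorem `ScarEnvelopeTypeI_of_stubs` is byte-identical except that SD is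
now the theorem `sliceOctaveBudget_of_kills`; the `sorry`s in its cone are exactly {`stub_fatKill`,
`stub_dustKill`}.  No statement of S0 / SA / SB / SD / `noTameTwinScar` changed.  No summit statement is
proved; 23843 / TypeIQuarterGate / NS regularity OPEN.
-/

namespace Summit.NavierStokesRegularity.NavierStokesRegularity.Cruxes.ScarEnvelopeTypeI.SliceBudget

open MeasureTheory Set Filter Topology
open scoped ENNReal
open Literature.Analysis Literature.Analysis.FluidPDE Literature.Analysis.FluidPDE.LocalTypeIBlowup

local notation "E3" => EuclideanSpace ℝ (Fin 3)

/-! ## Definitions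

VERSION 5: all definitions of this line are LANDED tree declarations used BY NAME — the five shared
with line `scar_zoom` (`CruxHypotheses`, `Envelope`, `TameOutside`, `ScarViolators`, `SingularAt`;
`Theorems/TypeIQuarterGateScarZoomDefs.lean`, p606736, opened below) and the five of this line
(`SingularPt`, `OctaveBudget`, `essTranslate`, `ESSClassAt`, `TameTwinScar`;
`Theorems/TypeIQuarterGateSliceBudgetDefs.lean`, p612755, declared in this very namespace, so no
`open` is needed).  STUB 0 and STUB A are the LANDED theorems `ScarZoom.stub_blowupIsCompact`
(p611204) and `ScarZoom.stub_violatorsApproachScar` (p607379); `scar_zoom`'s twin zoom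
`ScarZoom.stub_scarZoom` (p610713) is imported for the prover of STUB B.  Nothing landed is a
`sorry` here. -/

open Summit.NavierStokesRegularity.NavierStokesRegularity.Cruxes.ScarEnvelopeTypeI.ScarZoom
  (CruxHypotheses Envelope TameOutside ScarViolators SingularAt TwinScarObject
    stub_blowupIsCompact stub_violatorsApproachScar stub_scarZoom)

/-! ## Registered stubs -/

/-- SD AS A NAMED PROP (v7): token-identical to the statement of v1–v6's registered deciding stub
`stub_sliceOctaveBudget`. -/
def SD : Prop :=
    ∀ (ν T : ℝ) (u : ℝ → E3 → E3) (p : ℝ → E3 → ℝ),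
      CruxHypotheses ν T u p → TameOutside T u → OctaveBudget ν T u

/-! ## v7 — the `H¹` seam of SD (KEY-NS #108 (3); LEAD ns-sz-p1 g4 08:58:03Z) -/

/-- THE ALBRITTON–BARKER CLASS in which the tree's scar zooms land — verbatim the first five
conjuncts of the conclusion of the LANDED `exists_typeIAncientMild_twinZoomLimit_budget` (p614802):
KNSS-gauge Type-I ancient mild with constant `M`; suitable weak (Lin / A–B Def. 2.1) in EVERY backward
parabolic ball `Q_{R'}(0,0)` at the top vertex; suitable weak on the open past slab; a weak spatial
gradient `H` there; A–B's scale-invariant Type-I quantity `𝐈((−∞,0) × ℝ³) < ⊤` (the Morrey bound at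
all points and scales). [cite: AlbrittonBarker2019, §1, Def. 2.1] -/
def ABClass (M : ℝ) (U : ℝ → E3 → E3) (P : ℝ → E3 → ℝ) (H : ℝ → E3 → E3 →L[ℝ] E3) : Prop :=
  IsTypeIAncientMild M U ∧
    (∀ R' : ℝ, 0 < R' → IsSuitableWeakSolutionInBall R' ((0 : ℝ), (0 : E3)) U P) ∧
    IsSuitableWeakSolutionOn (slab E3 (Iio 0) isOpen_Iio) 1 0 U P ∧
    HasWeakSpatialGradientOn (slab E3 (Iio 0) isOpen_Iio) U H ∧
    typeIBound (Iio (0 : ℝ) ×ˢ univ) U P H < ⊤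

/-- THE FINAL-TIME SINGULAR SET of an ancient object: the points `x` such that `(0, x)` is a
backward singular point (`U ∉ L^∞(Q_r(0,x))` for every `r > 0`, A–B §1). -/
def finalSingularSet (U : ℝ → E3 → E3) : Set E3 :=
  {x | IsBackwardSingularPoint U ((0 : ℝ), x)}

/-- `U` IS A ZOOM LIMIT OF `u` AT `(T, a)`: along some scales `λₙ → 0⁺`, centres `xₙ → a` and vertex
times `tₙ ≤ T` with `(T − tₙ)/λₙ² → 0`, the Navier–Stokes rescalings `λₙ u(tₙ + λₙ² s, xₙ + λₙ y)`
converge to `U(s, y)` POINTWISE on the open past `s < 0` (the weakest convergence, so that «all zoom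
limits» is the largest family; subsequences are absorbed by re-indexing). -/
def IsZoomLimitAt (T : ℝ) (u : ℝ → E3 → E3) (a : E3) (U : ℝ → E3 → E3) : Prop :=
  ∃ (lam : ℕ → ℝ) (xc : ℕ → E3) (tc : ℕ → ℝ),
    (∀ n, 0 < lam n) ∧ Tendsto lam atTop (𝓝 0) ∧ Tendsto xc atTop (𝓝 a) ∧ (∀ n, tc n ≤ T) ∧
    Tendsto (fun n => (T - tc n) / lam n ^ 2) atTop (𝓝 0) ∧
    ∀ s : ℝ, s < 0 → ∀ y : E3,
      Tendsto (fun n => lam n • u (tc n + lam n ^ 2 * s) (xc n + lam n • y)) atTop (𝓝 (U s y))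

/-- ONLY DUST AT `(T, a)`: every A–B-class zoom limit of `u` at `(T, a)` has `H¹`-null final-time
singular set. -/
def FinalDustOnly (T : ℝ) (u : ℝ → E3 → E3) (a : E3) : Prop :=
  ∀ (M : ℝ) (U : ℝ → E3 → E3) (P : ℝ → E3 → ℝ) (H : ℝ → E3 → E3 →L[ℝ] E3),
    ABClass M U P H → IsZoomLimitAt T u a U → μH[1] (finalSingularSet U) = 0

/-- SF — THE `H¹`-FAT KILL (class form): every object of the A–B class has `H¹`-null final-time
singular set.  CKN 1982 at the top time under the Morrey bound; no Liouville theorem involved. -/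
def FatKill : Prop :=
  ∀ (M : ℝ) (U : ℝ → E3 → E3) (P : ℝ → E3 → ℝ) (H : ℝ → E3 → E3 →L[ℝ] E3),
    ABClass M U P H → μH[1] (finalSingularSet U) = 0

/-- SK — THE DUST KILL (deciding): the slice-wise octave budget for crux-class blow-ups all of whose
A–B-class zoom limits, at every point, carry only `H¹`-null final-time singular sets.  SD with the
fat scenarios removed; strictly below SD. -/
def DustKill : Prop :=
  ∀ (ν T : ℝ) (u : ℝ → E3 → E3) (p : ℝ → E3 → ℝ),
    CruxHypotheses ν T u p → TameOutside T u → (∀ a : E3, FinalDustOnly T u a) → OctaveBudget ν T u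

/-- STUB F (SF; size L; PROVABLE NOW — top-time CKN under the Morrey bound `𝐈 < ⊤`: Seregin 2014
L.6.2 / L.6.4 (`exists_cknC_le_decay`, `pressureEstimateMeanZero_top`) ⇒ `exists_epsilonRegularity_top`
(Prop 1.4(1)); contrapositive: at a final-time singular `x` some top-vertex backward cylinder has
`ρ⁻¹∫∫_{Q_ρ(0,x)}|∇U|² ≥ η₀(K)` at arbitrarily small `ρ`; spatial Vitali + absolute continuity of
`∫∫|∇U|²` (finite on every `Q_{R'}(0,0)` by `ABClass`) on the shrinking slabs `(−ρ², 0)` ⇒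
`μH[1](finalSingularSet U ∩ B_{R'/2}) = 0` for every `R'`, hence `= 0` (Mathlib
`hausdorffMeasure_le_liminf_sum`).  Claimed by LEAD ns-sz-p1 g4 (announce 08:58:03Z).  Why it might
fail: it does not — the risk is only the top-time bookkeeping of the tree's ε-regularity (all cited
pieces are PROVED tree theorems).  [cite: CaffarelliKohnNirenberg1982, Thm B / Prop 2;
Seregin2014 Lecture Notes, L.6.2, L.6.4, Prop 1.4] -/
theorem stub_fatKill : FatKill := by
  sorry

/-- STUB K (SK; DECIDING; open; XL, strictly below SD).  THE DUST KILL: SD for blow-ups whose scar zoom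
limits carry no `H¹`-fat final-time singularity.  RESIDUAL ENEMY (the null table's one-dimensional
enemy minus everything SF kills): far-annulus concentrations all of whose zoom limits are `H¹`-null at
the final time — `N_k → ∞` parabolic grains clustering GEOMETRICALLY onto points (cube
`≍ C₀³ log(ℓ²/(T−t))`, Barker–Prange 2021's lower-bound shape [corpus:paper-arxiv-2211.16215 p.14])
or Cantor dusts of dimension `< 1`; their zoom limits are multi- or Cantor-scar Type-I ancient objects (the
S_C′ wall generalised; budgeted twin scars still die by `noTameTwinScar`).  Why it might fail: a
rate-Type-I blow-up fed by a geometrically clustering grain swarm (unknown; compatible with the energy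
inequality and with SF).  Instrument row: box-counting dimension of grain centres per far annulus in
Type-I-rate candidate numerics (p3's `N_far`/`H` words): `≥ 1` persisting to `T` ⇒ SF's side (dead by
CKN), `< 1` ⇒ census for SK.  [cite: BarkerPrange2021CMP, Thm 2 / survey arXiv:2211.16215 p.14] -/
theorem stub_dustKill : DustKill := by
  sorry

/-- `SD_of` — THE SPLIT, KERNEL-CHECKED: the fat kill supplies the dust kill's hypothesis at every
point (whether or not the A–B object is a zoom limit), so SF → SK → SD. -/
theorem SD_of (hF : FatKill) (hK : DustKill) : SD :=
  fun ν T u p H hT => hK ν T u p H hT (fun _a M U P H' hAB _hz => hF M U P H' hAB)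

/-- STUB D (SD) — v7: NO LONGER A `sorry`: the theorem `SD_of stub_fatKill stub_dustKill`, statement
token-identical to v1–v6's registered `stub_sliceOctaveBudget` (= the Prop `SD` above).  THE SLICE-WISE OCTAVE BUDGET: a Type-I (time-rate)
blow-up of a smooth Leray–Hopf solution from rapidly decaying data with finitely many scars deposits,
at each time near `T`, at most `q` of cube on every e-annulus around each scar at parabolically
admissible radii.  WEAKER THAN THE CRUX (implied by `Envelope`, see `OctaveBudget`).  THE NEAR-MISS:
with the vertex `(T, a)`, the tree theorem `scaledEnergies_bounded_of_typeIRate` (its finiteness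
inputs `C(r₀), D(r₀) < ∞` hold for Leray–Hopf solutions by `L^{10/3}` interpolation and the `L^{5/3}`
Riesz pressure) gives SLICE-WISE `∫_{B(a,r)}|u(t)|² ≤ K r` and TIME-AVERAGED
`r⁻²∫_{T−r²}^{T}∫_{B(a,r)}|u|³ ≤ K` for all small `r`; the stub asks for the cube SLICE-WISE.
ENEMY CENSUS (what the gap consists of): an e-annulus at radius `ℓ ≫ √(T−t)` with `L²` mass `≤ Keℓ`
(forced) but cube `≫ 1` must carry Type-I-amplitude (`≈ C₀/√(T−t)`) structures of total volume
`≈ Kℓ(T−t)/C₀²`: FAT SHELLS are thereby excluded slice-wise (amplitude `≤ K/ℓ` = envelope size);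
Type-I FILAMENTS spanning the annulus: HEURISTIC clause only (v2, critic P2) — CKN's `P¹(S) = 0`
bites a filament that PERSISTS to time `T` at a fixed location (then the zoom of STUB B produces a
final-time singular set of positive `H¹`-measure), while a TRANSIENT filament present at one slice
is excluded by nothing named here; the straight collapsing tube is axisymmetric Type-I, excluded by
KNSS 2009 / Seregin–Šverák 2009; so the RESIDUAL enemy is «a CONDENSING SWARM of `N → ∞` parabolic
blobs OR TRANSIENT FILAMENTS in one far annulus» (a single blob costs only `O(C₀³)` and is handled by
STUB B + `noTameTwinScar`, not here).  ON THE DSS WALL the stub holds with positive width (enveloped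
backward λ-DSS / self-similar blow-up: `q = sup_R ∫_{R<|y|<eR}|U|³`).  TWO-SIDED NEAR-MISS (v2,
critic P1): the octave budget is SHARP IN ORDER — Barker–Prange 2021 (CMP), Result 1 of the
Barker–Prange survey [corpus:paper-arxiv-2211.16215 p.14, «localized quantitative rate of blow-up»;
mechanism p.15: a per-annulus LOWER bound summed over «annuli of quantitative regularity»]: for a
first-time blow-up with `A := ‖U‖_{L^∞(0,T*; L^{3,∞})} < ∞` (a Type-I singular point at the origin),
`∫_{|x|<R} |U(x,t)|³ ≥ log(R²/(A^{802}(T*−t))) / exp(exp(A^{1025}))` for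
`√((T*−t)/S(A)) < R < e^{A^{1022}}√T*`, `S(A) ≃ A^{−30}`.  Since `Envelope` puts `u(t)` in
`L^{3,∞}_loc` uniformly, an enveloped blow-up has MEAN octave cube pinched between the two:
`c(A) ≤ (1/#octaves) Σ_j m_{e^j ℓ₀}(t) ≤ q` — no `o(log)` strengthening of this stub can hold for
an enveloped blow-up, and «BP21 not binding» means precisely: lower vs upper side of the same
budget, stated in the weak-`L³` Type-I class rather than the rate class.  Why it might fail: a
rate-Type-I blow-up whose collapse is fed by ever denser swarms of parabolic-size eddies converging
on the scar from parabolically far out (no such scenario is known or numerically observed; it is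
compatible with the energy inequality).  Instrument row: in Type-I-rate candidate numerics
(pub-ns-blowup / pub-ns-dss) record the slice-wise annular cube `m_ℓ(t)` around the collapse centre
against its parabolic time average (which the tree bounds) AND against both sides of the budget
(BP21's `c(A)` mean lower bound, this stub's `q`): bounded ratio ⇒ consistent, growing blob
counts per annulus ⇒ STRIKE. -/
theorem sliceOctaveBudget_of_kills :
    ∀ (ν T : ℝ) (u : ℝ → E3 → E3) (p : ℝ → E3 → ℝ),
      CruxHypotheses ν T u p → TameOutside T u → OctaveBudget ν T u :=
  SD_of stub_fatKill stub_dustKill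

/-! STUB B `stub_tameScarZoom` (SB) — LANDED (ns-sz-p1 g3, p615740,
`Theorems/TypeIQuarterGateScarEnvelopeTypeITameScarZoom.lean`): `CruxHypotheses ν T u p → OctaveBudget ν T u →
ScarViolators T u → ∃ M v, TameTwinScar M v`, proved by the Morrey zoom (β = R²/ν, α = R/ν), the violators
(scar = singular point, `SingularPt`), scale invariance of the slice-wise budget (νβ = R²), the twin zoom
with budget (`exists_typeIAncientMild_twinZoomLimit_budget`: Albritton–Barker class on every ball up to the
final time + Fatou on slices) and the ESS packaging at `(0, e)` (`essClassAt_of_inBall_of_budget`).  Used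
BY NAME below. -/


/-! ## Proved: ESS kills the second scar -/

/-- NO TAME TWIN-SCAR OBJECT (PROVED; this is where the 2003 theorem replaces `scar_zoom`'s open
one-point-rigidity Liouville stub).  ESS Thm 1.4 (`ess_local_holder_holds`) makes the normalised
translate `w` Hölder continuous on the closure of `Q(1/2)`, a.e. equal to `w`; `w` is continuous on
the open cylinder (the KNSS gauge is jointly smooth on the open past), so the two agree everywhere on
`Q(1/2)` and `w` is bounded there; undoing the normalisation bounds `v` on `(−1/16, 0) × B(e, 1/4)`,
contradicting `SingularAt v e`. -/
theorem noTameTwinScar (M : ℝ) (v : ℝ → E3 → E3) : ¬ TameTwinScar M v := by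
  rintro ⟨hv, -, e, -, hsing, π, hns, hL2, hgrad, hπ, hL3⟩
  obtain ⟨w, C, α, hα, hHolder, hae⟩ :=
    Literature.Analysis.FluidPDE.ess_local_holder_holds (essTranslate v e) π hns hL2 hgrad hπ hL3
  set Q : Set (ℝ × E3) :=
    Literature.Analysis.FluidPDE.parabolicCylinder (1 / 2) ((0 : ℝ), (0 : E3)) with hQdef
  have hQopen : IsOpen Q := Literature.Analysis.FluidPDE.isOpen_parabolicCylinder _ _
  have hmemQ : ∀ z : ℝ × E3, z ∈ Q ↔ (-(1 / 4 : ℝ) < z.1 ∧ z.1 < 0) ∧ ‖z.2‖ < 1 / 2 := by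
    intro z
    simp only [hQdef, Literature.Analysis.FluidPDE.parabolicCylinder, Set.mem_prod, Set.mem_Ioo,
      Metric.mem_ball, dist_zero_right]
    norm_num
  -- continuity of the normalised translate on the open cylinder
  have hφ : Continuous fun z : ℝ × E3 => (z.1 / 4, e + (1 / 2 : ℝ) • z.2) := by fun_prop
  have hmaps : Set.MapsTo (fun z : ℝ × E3 => (z.1 / 4, e + (1 / 2 : ℝ) • z.2)) Q
      (Set.Iio (0 : ℝ) ×ˢ (Set.univ : Set E3)) := by
    intro z hz
    refine ⟨?_, Set.mem_univ _⟩
    have h := ((hmemQ z).1 hz).1.2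
    show z.1 / 4 < 0
    linarith
  have hcomp : ContinuousOn
      (fun z : ℝ × E3 => Function.uncurry v (z.1 / 4, e + (1 / 2 : ℝ) • z.2)) Q :=
    hv.continuousOn_uncurry.comp hφ.continuousOn hmaps
  have hcont : ContinuousOn (Function.uncurry (essTranslate v e)) Q := by
    have : Function.uncurry (essTranslate v e) =
        fun z : ℝ × E3 => (1 / 2 : ℝ) • Function.uncurry v (z.1 / 4, e + (1 / 2 : ℝ) • z.2) := by
      funext z; rfl
    rw [this]
    exact hcomp.const_smul (1 / 2 : ℝ)
  have hwcont : ContinuousOn w Q := (hHolder.continuousOn hα).mono subset_closure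
  have heq : Set.EqOn (Function.uncurry (essTranslate v e)) w Q :=
    Measure.eqOn_open_of_ae_eq hae hQopen hcont hwcont
  -- a bound for `w` on `Q` from the Hölder seminorm
  set z₀ : ℝ × E3 := ((-(1 / 8) : ℝ), (0 : E3)) with hz₀def
  have hz₀ : z₀ ∈ Q := by
    rw [hmemQ]
    refine ⟨⟨?_, ?_⟩, ?_⟩ <;> simp [hz₀def] <;> norm_num
  have hbound : ∀ z ∈ Q, ‖w z‖ ≤ ‖w z₀‖ + C := by
    intro z hz
    have hzQ := (hmemQ z).1 hz
    have hd : dist z z₀ ≤ 1 := by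
      rw [Prod.dist_eq]
      refine max_le ?_ ?_
      · rw [Real.dist_eq]
        have h1 := hzQ.1.1
        have h2 := hzQ.1.2
        rw [abs_le]
        constructor <;> simp [hz₀def] <;> linarith
      · rw [dist_eq_norm]
        simp only [hz₀def, sub_zero]
        linarith [hzQ.2]
    have hdist : dist (w z) (w z₀) ≤ C * (1 : ℝ) ^ (α : ℝ) :=
      hHolder.dist_le_of_le (subset_closure hz) (subset_closure hz₀) hd
    rw [Real.one_rpow, mul_one] at hdist
    calc ‖w z‖ ≤ ‖w z₀‖ + ‖w z - w z₀‖ := norm_le_insert' _ _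
      _ = ‖w z₀‖ + dist (w z) (w z₀) := by rw [dist_eq_norm]
      _ ≤ ‖w z₀‖ + C := by linarith
  -- the singular point `e` contradicts the bound
  obtain ⟨t, ht, y, hy, hA⟩ := hsing (1 / 4) (by norm_num) (2 * (‖w z₀‖ + C))
  rw [Set.mem_Ioo] at ht
  rw [Metric.mem_ball, dist_eq_norm] at hy
  set z : ℝ × E3 := ((4 : ℝ) * t, (2 : ℝ) • (y - e)) with hzdef
  have hz : z ∈ Q := by
    rw [hmemQ]
    refine ⟨⟨?_, ?_⟩, ?_⟩
    · show -(1 / 4 : ℝ) < 4 * t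
      nlinarith [ht.1]
    · show (4 : ℝ) * t < 0
      linarith [ht.2]
    · show ‖(2 : ℝ) • (y - e)‖ < 1 / 2
      rw [norm_smul, Real.norm_eq_abs, abs_of_pos (by norm_num : (0 : ℝ) < 2)]
      linarith
  have hval : Function.uncurry (essTranslate v e) z = (1 / 2 : ℝ) • v t y := by
    show (1 / 2 : ℝ) • v ((4 : ℝ) * t / 4) (e + (1 / 2 : ℝ) • ((2 : ℝ) • (y - e))) =
      (1 / 2 : ℝ) • v t y
    have h1 : (4 : ℝ) * t / 4 = t := by ring
    have h2 : e + (1 / 2 : ℝ) • ((2 : ℝ) • (y - e)) = y := by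
      rw [smul_smul, show (1 / 2 : ℝ) * 2 = 1 by norm_num, one_smul, add_sub_cancel]
    rw [h1, h2]
  have hwz : ‖w z‖ ≤ ‖w z₀‖ + C := hbound z hz
  have hvy : ‖v t y‖ = 2 * ‖w z‖ := by
    rw [← heq hz, hval, norm_smul, Real.norm_eq_abs, abs_of_pos (by norm_num : (0 : ℝ) < 1 / 2)]
    ring
  linarith

/-! ## Composition

VERSION 5/6 (LEAD): `ScarEnvelopeTypeI_of_stubs` is THE skeleton theorem — the crux BY NAME from the
landed STUB 0 / STUB A / STUB B (v6), the registered deciding stub SD and the proved ESS leg, with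
exactly the registered `sorry` (SD) in its cone.  The parametric composition (v1–v4's `ScarEnvelopeTypeI_of`: the
four stub STATEMENTS imply the crux) is kept as a kernel-checked `example`: the registry's skeleton
audit (`#h21_check_skeleton`) takes the first crux-concluding THEOREM of the file in environment
order and reads parametric hypotheses as unregistered obligations (`skeleton.extra-hypothesis`), so
the parametric form must not be a named theorem here.  No statement of a stub changed. -/

/-- THE SKELETON (kernel-checked; v7: the only `sorry`s in its cone are the two new stubs SF
`stub_fatKill` and SK `stub_dustKill`, through `sliceOctaveBudget_of_kills = SD_of SF SK`; STUB 0,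
STUB A, STUB B are landed theorems used BY NAME): the crux BY NAME.
Violators of the envelope (STUB A) at a scar of a tame (STUB 0) Type-I blow-up carrying the octave
budget (SD) zoom to a tame twin-scar object (STUB B), which ESS 2003 Thm 1.4 forbids
(`noTameTwinScar`). -/
theorem ScarEnvelopeTypeI_of_stubs :
    Summit.NavierStokesRegularity.NavierStokesRegularity.Theses.TypeIQuarterGate.ScarEnvelopeTypeI := by
  intro ν T hν hT u p hmax hLH hdec hTI hfin
  by_contra hEnv
  have H : CruxHypotheses ν T u p := ⟨hν, hT, hmax, hLH, hdec, hTI, hfin⟩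
  have hTame : TameOutside T u := stub_blowupIsCompact ν T u p H
  obtain ⟨M, v, hv⟩ := stub_tameScarZoom ν T u p H (sliceOctaveBudget_of_kills ν T u p H hTame)
    (stub_violatorsApproachScar ν T u p H hTame hEnv)
  exact noTameTwinScar M v hv

/-- COMPOSITION, PARAMETRIC FORM (kernel-checked, no `sorry`; v1–v4's `ScarEnvelopeTypeI_of`): the
four stub STATEMENTS S0 → SA → SD → SB prove the crux BY NAME; the ESS leg is the proved
`noTameTwinScar`. -/
example :
    (∀ (ν T : ℝ) (u : ℝ → E3 → E3) (p : ℝ → E3 → ℝ),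
        CruxHypotheses ν T u p → TameOutside T u) →
    (∀ (ν T : ℝ) (u : ℝ → E3 → E3) (p : ℝ → E3 → ℝ),
        CruxHypotheses ν T u p → TameOutside T u → ¬ Envelope T u → ScarViolators T u) →
    (∀ (ν T : ℝ) (u : ℝ → E3 → E3) (p : ℝ → E3 → ℝ),
        CruxHypotheses ν T u p → TameOutside T u → OctaveBudget ν T u) →
    (∀ (ν T : ℝ) (u : ℝ → E3 → E3) (p : ℝ → E3 → ℝ),
        CruxHypotheses ν T u p → OctaveBudget ν T u → ScarViolators T u →
          ∃ (M : ℝ) (v : ℝ → E3 → E3), TameTwinScar M v) →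
      Summit.NavierStokesRegularity.NavierStokesRegularity.Theses.TypeIQuarterGate.ScarEnvelopeTypeI := by
  intro h0 hA hD hB ν T hν hT u p hmax hLH hdec hTI hfin
  by_contra hEnv
  have H : CruxHypotheses ν T u p := ⟨hν, hT, hmax, hLH, hdec, hTI, hfin⟩
  have hTame : TameOutside T u := h0 ν T u p H
  obtain ⟨M, v, hv⟩ := hB ν T u p H (hD ν T u p H hTame) (hA ν T u p H hTame hEnv)
  exact noTameTwinScar M v hv

end Summit.NavierStokesRegularity.NavierStokesRegularity.Cruxes.ScarEnvelopeTypeI.SliceBudget
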